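import Summits.KontsevichZagierPeriods.Zeta5Search.TwoTaleP15FirstTale
import Summits.KontsevichZagierPeriods.Zeta5Search.Denom.TwoTaleR3Forms

/-!
# Rung A of the two-tale ladder: first-tale arithmetic in the kernel (Zudilin 2014, Lemma 7 at rung A)

HONEST FRAMING: systematic search; no irrationality claim unless certified.

Cell pub-zeta5, T3 service.  **Rung A** is Zudilin's own `ζ(2)` point [Zudilin2014ZetaTwo, Remark 3]:
`a = (6n+1, 5n+1, 4n+1, 7n+1)`, `b = (1, n+1, 2n+1, 12n+2)` (fam-denom's `Denom.TwoTaleR3Forms.aRungA/bRungA`, forms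
`formQA n := formQZ a b ∈ ℤ`, `formPA n := formP a b`, normaliser `D₇ₙ²`, saving product `savingProductA` over the
7 intervals `Denom.TwoTaleR3Saving.ivlA`, `8n < p²`).  Unlike P15, the first tale ALONE reaches every level of the
digit table, so the inclusion input `InclusionA` needs neither the second tale nor a two-tale coincidence.
This file is the rung-A twin of `TwoTaleP15FirstTale`:

* `amaxA_eq = 7n+1`, `a2starA_eq = 5n+1`, `dExpA_eq = 7n−1`; `pAnum n := formPZ a b (7n) (7n) = D₇ₙ² · p_n ∈ ℤ`
  (`pAnum_cast`), `denom_hypsA`;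
* **`cell_ruleA`** — for `σ ∈ S₄` with slopes `α' = α ∘ σ` written `α'₁ = c₀`, `α'₂ = c₁+1`, `α'₃ = c₂+2`,
  `α'₄ = 12 − c₃`, and a prime `p` with `8n < p²`:
  `ord_p Π(a,b)/Π(σa,b) = (⌊5x⌋−⌊6x⌋−⌊4x⌋−⌊2x⌋) − (⌊c₃x⌋−⌊c₀x⌋−⌊c₁x⌋−⌊c₂x⌋)`, `x = {n/p}`, read off from first
  Legendre digits (every factorial argument is `≤ 8n < p²`), and `p^e` divides `formQA n` and `pAnum n` for every `e`
  below it (`pow_dvd_formQZ`/`pow_dvd_formPZ`, i.e. Lemma 7 with the `S₄`-symmetry `formQ_perm`/`formP_perm`).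
The cells and the 7 interval theorems are in `TwoTaleRungACells`; the assembly to `InclusionA` in `TwoTaleRungAInclusion`.
Witness table: HOME `code/p1/g9/rungA_cells.py` (reproduces fam-denom's `ivlA` exactly: `{φ ≥ 1} = ivlA 0 ∪ 1 ∪ 2`,
`{φ = 2} = ivlA 3 ∪ 4 ∪ 5 ∪ 6`, 14 sub-cells).
-/

noncomputable section

namespace Summit.KontsevichZagierPeriods.Zeta5Search.TwoTaleRungA

open Finset
open Literature.NumberTheory.Irrationality.Zudilin2014
open Denom.TwoTaleR3Forms (slopeRungA aRungA bRungA admissibleA formQA formPA aRungA_zero aRungA_one aRungA_two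
  aRungA_three bRungA_zero bRungA_one bRungA_two bRungA_three)
open TwoTaleP15 (mkPerm mkPerm_apply mul_div_eq_of_digit)

/-- Bounds `4 ≤ α_i ≤ 7`. -/
theorem slope_bounds (i : Fin 4) : 4 ≤ slopeRungA i ∧ slopeRungA i ≤ 7 := by
  fin_cases i <;> decide

/-- `Σ α_i = 22`. -/
theorem sum_slope : ∑ i, slopeRungA i = 22 := by decide

/-- `a₄* = 7n + 1`. -/
theorem amaxA_eq (n : ℕ) : amax (aRungA n) = 7 * (n : ℤ) + 1 := by
  unfold amax; simp only [aRungA_zero, aRungA_one, aRungA_two, aRungA_three]; omega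

/-- `a₂* = 5n + 1`. -/
theorem a2starA_eq (n : ℕ) : a2star (aRungA n) = 5 * (n : ℤ) + 1 := by
  apply le_antisymm
  · unfold a2star
    refine sup'_le _ _ fun i _ => ?_
    by_cases hi : i = 1
    · subst hi
      calc minOthers (aRungA n) 1 ≤ aRungA n 2 := minOthers_le (aRungA n) (by decide)
        _ ≤ 5 * (n : ℤ) + 1 := by rw [aRungA_two]; omega
    · calc minOthers (aRungA n) i ≤ aRungA n 1 := minOthers_le (aRungA n) (fun h => hi h.symm)
        _ = 5 * (n : ℤ) + 1 := aRungA_one n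
  · have h : 5 * (n : ℤ) + 1 ≤ minOthers (aRungA n) 2 := by
      unfold minOthers
      refine le_inf' _ _ fun j hj => ?_
      have hj' : j ≠ 2 := (mem_erase.1 hj).1
      fin_cases j <;> simp at hj' ⊢ <;> omega
    exact h.trans (le_sup' (minOthers (aRungA n)) (mem_univ 2))

/-- `d = 7n − 1`. -/
theorem dExpA_eq (n : ℕ) : dExp (aRungA n) (bRungA n) = 7 * n - 1 := by
  unfold dExp
  simp only [Fin.sum_univ_four, bRungA_zero, bRungA_one, bRungA_two, bRungA_three, aRungA_zero, aRungA_one,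
    aRungA_two, aRungA_three]
  omega

/-- **`D₇ₙ² · p_n` at rung A** (an integer; Proposition 1 gives `D₇ₙ D₇ₙ p_n ∈ ℤ`). -/
def pAnum (n : ℕ) : ℤ := formPZ (aRungA n) (bRungA n) (7 * n) (7 * n)

/-- The denominator hypotheses of `formP_eq_cast` at rung A hold for every permutation of `a`. -/
theorem denom_hypsA {n : ℕ} (hn : 1 ≤ n) (σ : Equiv.Perm (Fin 4)) :
    (∀ j : Fin 4, j ≠ 3 → ((aRungA n ∘ σ) j - bRungA n j).toNat ≤ 7 * n) ∧
      (bRungA n 3 - a2star (aRungA n) - 1).toNat ≤ 7 * n ∧ (bRungA n 3 - a2star (aRungA n) - 1).toNat ≤ 7 * n ∧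
      dExp (aRungA n) (bRungA n) + 1 ≤ 7 * n := by
  refine ⟨fun j hj => ?_, ?_, ?_, ?_⟩
  · have hb : 1 ≤ bRungA n j := by fin_cases j <;> simp at hj ⊢
    have ha : (aRungA n ∘ σ) j ≤ 7 * (n : ℤ) + 1 := by
      simp only [Function.comp_apply]
      generalize σ j = i
      fin_cases i <;> simp <;> omega
    omega
  · rw [a2starA_eq, bRungA_three]; omega
  · rw [a2starA_eq, bRungA_three]; omega
  · rw [dExpA_eq]; omega

/-- `pAnum n = D₇ₙ D₇ₙ · p(a,b) = D₇ₙ² · formPA n`. -/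
theorem pAnum_cast {n : ℕ} (hn : 1 ≤ n) :
    (pAnum n : ℚ) = (Nat.lcmUpto (7 * n) : ℚ) * Nat.lcmUpto (7 * n) * formPA n := by
  have h := denom_hypsA hn 1
  simp only [Equiv.Perm.coe_one, Function.comp_id] at h
  exact (formP_eq_cast (admissibleA hn) h.1 h.2.1 h.2.2.1 h.2.2.2).symm

/-! ### Lemma 7 at rung A: the digit rule -/

/-- **The digit rule (Lemma 7 at rung A, one permutation).**  Let `σ ∈ S₄` with slopes `α'_j = α_{σ j}` written as
`α'₁ = c₀`, `α'₂ = c₁ + 1`, `α'₃ = c₂ + 2`, `α'₄ = 12 − c₃`; let `p` be a prime with `8n < p²` and first digits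
`j₅ = ⌊5x⌋, j₆, j₄, j₂`, `k₃ = ⌊c₃x⌋, k₀ = ⌊c₀x⌋, k₁, k₂` at `x = {n/p}`.  Then
`ord_p Π(a,b)/Π(σa,b) = (j₅−j₆−j₄−j₂) − (k₃−k₀−k₁−k₂)` and for every `e` below it, `p^e ∣ q_n` and
`p^e ∣ D₇ₙ² p_n` [Zudilin2014ZetaTwo, Lemma 7 and Remark 3]. -/
theorem cell_ruleA (σ : Equiv.Perm (Fin 4)) (c0 c1 c2 c3 : ℕ)
    (hσ0 : slopeRungA (σ 0) = c0) (hσ1 : slopeRungA (σ 1) = c1 + 1) (hσ2 : slopeRungA (σ 2) = c2 + 2)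
    (hσ3 : slopeRungA (σ 3) + c3 = 12)
    {n p : ℕ} (hn : 1 ≤ n) (hp : p.Prime) (hp2 : 8 * n < p ^ 2)
    (j5 j6 j4 j2 k3 k0 k1 k2 : ℕ)
    (h5 : j5 * p ≤ 5 * (n % p) ∧ 5 * (n % p) < (j5 + 1) * p)
    (h6 : j6 * p ≤ 6 * (n % p) ∧ 6 * (n % p) < (j6 + 1) * p)
    (h4 : j4 * p ≤ 4 * (n % p) ∧ 4 * (n % p) < (j4 + 1) * p)
    (h2 : j2 * p ≤ 2 * (n % p) ∧ 2 * (n % p) < (j2 + 1) * p)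
    (g3 : k3 * p ≤ c3 * (n % p) ∧ c3 * (n % p) < (k3 + 1) * p)
    (g0 : k0 * p ≤ c0 * (n % p) ∧ c0 * (n % p) < (k0 + 1) * p)
    (g1 : k1 * p ≤ c1 * (n % p) ∧ c1 * (n % p) < (k1 + 1) * p)
    (g2 : k2 * p ≤ c2 * (n % p) ∧ c2 * (n % p) < (k2 + 1) * p)
    {e : ℕ} (he : (e : ℤ) ≤ ((j5 : ℤ) - j6 - j4 - j2) - ((k3 : ℤ) - k0 - k1 - k2)) :
    (p : ℤ) ^ e ∣ formQA n ∧ (p : ℤ) ^ e ∣ pAnum n := by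
  haveI : Fact p.Prime := ⟨hp⟩
  have hp0 : 0 < p := hp.pos
  have hadm := admissibleA hn
  -- the factorial arguments and their sizes
  have hsq : ∀ c : ℕ, c ≤ 8 → c * n < p ^ 2 := fun c hc => lt_of_le_of_lt (Nat.mul_le_mul_right n hc) hp2
  have hcsum : c0 + c1 + c2 = c3 + 7 := by
    have hs : ∑ i, slopeRungA (σ i) = 22 := by rw [Equiv.sum_comp σ slopeRungA]; exact sum_slope
    rw [Fin.sum_univ_four] at hs; omega
  have hc3 : c3 ≤ 8 := by have := (slope_bounds (σ 3)).1; omega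
  have hc0 : c0 ≤ 8 := by have := (slope_bounds (σ 0)).2; omega
  have hc1 : c1 ≤ 8 := by have := (slope_bounds (σ 1)).2; omega
  have hc2 : c2 ≤ 8 := by have := (slope_bounds (σ 2)).2; omega
  -- the parameter differences
  have t3 : (bRungA n 3 - aRungA n 3 - 1).toNat = 5 * n := by simp only [bRungA_three, aRungA_three]; omega
  have t0 : (aRungA n 0 - bRungA n 0).toNat = 6 * n := by simp only [bRungA_zero, aRungA_zero]; omega
  have t1 : (aRungA n 1 - bRungA n 1).toNat = 4 * n := by simp only [bRungA_one, aRungA_one]; omega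
  have t2 : (aRungA n 2 - bRungA n 2).toNat = 2 * n := by simp only [bRungA_two, aRungA_two]; omega
  have cast3 : (slopeRungA (σ 3) : ℤ) + c3 = 12 := by exact_mod_cast hσ3
  have s3 : (bRungA n 3 - (aRungA n ∘ σ) 3 - 1).toNat = c3 * n := by
    have e : bRungA n 3 - (aRungA n ∘ σ) 3 - 1 = ((c3 * n : ℕ) : ℤ) := by
      simp only [Function.comp_apply, aRungA, bRungA_three]; push_cast
      linear_combination (-(n : ℤ)) * cast3
    rw [e, Int.toNat_natCast]
  have s0 : ((aRungA n ∘ σ) 0 - bRungA n 0).toNat = c0 * n := by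
    have e : (aRungA n ∘ σ) 0 - bRungA n 0 = ((c0 * n : ℕ) : ℤ) := by
      simp only [Function.comp_apply, aRungA, bRungA_zero, hσ0]; push_cast; ring
    rw [e, Int.toNat_natCast]
  have s1 : ((aRungA n ∘ σ) 1 - bRungA n 1).toNat = c1 * n := by
    have e : (aRungA n ∘ σ) 1 - bRungA n 1 = ((c1 * n : ℕ) : ℤ) := by
      simp only [Function.comp_apply, aRungA, bRungA_one, hσ1]; push_cast; ring
    rw [e, Int.toNat_natCast]
  have s2 : ((aRungA n ∘ σ) 2 - bRungA n 2).toNat = c2 * n := by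
    have e : (aRungA n ∘ σ) 2 - bRungA n 2 = ((c2 * n : ℕ) : ℤ) := by
      simp only [Function.comp_apply, aRungA, bRungA_two, hσ2]; push_cast; ring
    rw [e, Int.toNat_natCast]
  -- the valuations
  have v1 := padicValRat_Pi_eq (p := p) (a := aRungA n) (b := bRungA n)
    (by rw [t3]; exact hsq 5 (by norm_num)) (by rw [t0]; exact hsq 6 (by norm_num))
    (by rw [t1]; exact hsq 4 (by norm_num)) (by rw [t2]; exact hsq 2 (by norm_num))
  have v2 := padicValRat_Pi_eq (p := p) (a := aRungA n ∘ σ) (b := bRungA n)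
    (by rw [s3]; exact hsq c3 hc3) (by rw [s0]; exact hsq c0 hc0) (by rw [s1]; exact hsq c1 hc1)
    (by rw [s2]; exact hsq c2 hc2)
  rw [t3, t0, t1, t2, mul_div_eq_of_digit hp0 h5.1 h5.2, mul_div_eq_of_digit hp0 h6.1 h6.2,
    mul_div_eq_of_digit hp0 h4.1 h4.2, mul_div_eq_of_digit hp0 h2.1 h2.2] at v1
  rw [s3, s0, s1, s2, mul_div_eq_of_digit hp0 g3.1 g3.2, mul_div_eq_of_digit hp0 g0.1 g0.2,
    mul_div_eq_of_digit hp0 g1.1 g1.2, mul_div_eq_of_digit hp0 g2.1 g2.2] at v2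
  have hval : (e : ℤ) ≤ padicValRat p (Pi (aRungA n) (bRungA n)) - padicValRat p (Pi (aRungA n ∘ σ) (bRungA n)) := by
    rw [v1, v2]
    have hcs : (c0 : ℤ) + c1 + c2 = c3 + 7 := by exact_mod_cast hcsum
    have key : ((c0 : ℤ) + c1 + c2) * ((n / p : ℕ) : ℤ) = ((c3 : ℤ) + 7) * ((n / p : ℕ) : ℤ) := by rw [hcs]
    have hexp : ((5 * (n / p) + j5 : ℕ) : ℤ) - ((6 * (n / p) + j6 : ℕ) : ℤ) - ((4 * (n / p) + j4 : ℕ) : ℤ)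
          - ((2 * (n / p) + j2 : ℕ) : ℤ)
        - (((c3 * (n / p) + k3 : ℕ) : ℤ) - ((c0 * (n / p) + k0 : ℕ) : ℤ) - ((c1 * (n / p) + k1 : ℕ) : ℤ)
          - ((c2 * (n / p) + k2 : ℕ) : ℤ))
        = ((j5 : ℤ) - j6 - j4 - j2) - ((k3 : ℤ) - k0 - k1 - k2) := by
      push_cast at key ⊢
      linear_combination key
    rw [hexp]
    exact he
  have hd := denom_hypsA hn σ
  have hd1 := denom_hypsA hn 1
  simp only [Equiv.Perm.coe_one, Function.comp_id] at hd1
  exact ⟨pow_dvd_formQZ hadm σ hval, pow_dvd_formPZ hadm σ hd1.1 hd.1 hd.2.1 hd.2.2.1 hd.2.2.2 hval⟩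

end Summit.KontsevichZagierPeriods.Zeta5Search.TwoTaleRungA

end
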